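/-
Copyright (c) 2026 the pub-hodgecm-mathlib formalisation cell (harness21).  Prover seat hodgecm-mathlib-K2E3-p03 (g7), HCML Track B «K2-LIT» ∕ h413
(`stmt-HodgeConjecture-24833`), leaf (nsc-S-A′), brick GEO-QB‴ (route (T) «transport»), part 2 = (T-a): the `P₁₂`-standard module `D′(x,y)` IS the `P₂₁`-standard
module `D(y⁻¹, x⁻¹)` transported along the outer automorphism `θ = gkAutomorphism`.  2026-09-04.
-/
import Summits.HodgeConjecture.HodgeConjecture.Theorems.K2E3JacquetWeightTransport               -- (this seat) part 1: weight transport, `det_leviAut_gkAutomorphism_apply`; brings ★ T1, ★ E4b-T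
import Summits.HodgeConjecture.HodgeConjecture.Theorems.K2E3GL3StandardModuleDegeneratePrime    -- (this seat) WH0‴: the `D′(x,y)` currency; brings ★ STD-EMB (`D(η,ψ)`), ★ OneTwoLeviBookkeeping
import HarnessLib

/-!
# K2_E3 road (h413), leaf (nsc-S-A′), brick GEO-QB‴ part 2 (T-a) — `D′(x,y) = Ind_{P₁₂}(x ⊠ y∘det₂) ≃ Ind_{P₂₁}(y⁻¹∘det₂ ⊠ x⁻¹)^θ` along `θ(g) = w₀ ᵗg⁻¹ w₀`

Cell `pub/hodgecm-mathlib` (D-0151), Track B, seat K2E3-p03 (g7) (FREE brick GEO-QB‴ of K2E3-p17 (g8)'s S4 census v0.2; route (T) «=» dealer K2E3-plan (g4) 13:25:45Z).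
`--supports stmt-HodgeConjecture-24833 --as helper`; THEOREMS ONLY (no `def`, no instance, no notation, no named fact, no `sorry`); never imports `Cruxes/…/Lines`.  COUNT-NEUTRAL.

THE MATHEMATICS ([Zelevinsky1980, §1.1, Ex. 3.2]; [BernsteinZelevinsky1977, §1.7, §2.3]; [Bump1997, §4.4]).  `θ(g) = w₀ ᵗg⁻¹ w₀` maps `Q′ = P₁₂` onto `Q = P₂₁` and `U_Q` into `U_{Q′}`; on
the Levi of `Q′ ∋ q′` one has `proj_Q(θ q′) = (w₂ ᵗA⁻¹ w₂, λ⁻¹)` for `proj_{Q′} q′ = (λ, A)`, so the `Q`-datum `(y⁻¹∘det₂ ⊠ x⁻¹)·δ_Q^{1∕2}` pulls back to the `Q′`-datum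
`(x ⊠ y∘det₂)·δ_{Q′}^{1∕2}` (`δ_Q ∘ θ = δ_{Q′}`, ★ `rootDeltaChar_transport`; the block determinants of `θ(q′)` are `det(A)⁻¹` and `λ⁻¹`: `det θ(g) = (det g)⁻¹` and the
`GL₁`-block of `θ(q′)` is `(q′₀₀)⁻¹`).  Hence ★ `SmoothInd.transportEquiv` is a linear isomorphism **`Φ : D′(x,y) ≃ D(y⁻¹,x⁻¹)` with `Φ(D′(g) v) = D(θ g)(Φ v)`**
(`exists_transportEquiv_D'`) — the input of part 1's `finrank_weightSpace_eq_of_gkAutomorphism` (head file `K2E3GL3StandardModuleJacquetDimensionPrime`).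

HONEST LABEL: HC_CM is proved only modulo the 7 printed citations (2 remaining named inputs: hLiu418 = stmt-HodgeConjecture-24832, h413 = stmt-HodgeConjecture-24833) until rung 0
closes; count-neutral helper.

## Mathlib ∕ tree search
★ `SmoothInd.transportEquiv ∕ transportEquiv_smoothIndRep`, `rootDeltaChar_transport` (SmoothIndTransport); ★ T1 `coe_gkAutomorphism_apply`, `leviProjection_apply_eq_of_ker`,
`apply_eq_of_mem_unipotentRadicalGL`, `mem_unipotentRadicalGL_of_apply`, `mem_unipotentRadicalP_iff`; ★ STD-EMB `det_leviProjection_false_mul_true`, `det_leviProjection_twoOne_true`,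
`coe_leviProjection_eq_toSquareBlock`; ★ `det_leviProjection_oneTwo_false` (OneTwoLeviBookkeeping); Mathlib `Matrix.BlockTriangular.det_fintype`, `Matrix.det_transpose`,
`Matrix.det_submatrix_equiv_self`.  Dedup: `rg "transportEquiv_D|StandardModuleTransport|det_gkAutomorphism"` — none.

## References
* [Zelevinsky1980] A. V. Zelevinsky, *Induced representations of reductive p-adic groups II*, Ann. Sci. ÉNS 13 (1980), §1.1, Ex. 3.2.
* [BernsteinZelevinsky1977] I. N. Bernstein, A. V. Zelevinsky, *Induced representations of reductive p-adic groups I*, Ann. Sci. ÉNS 10 (1977), §1.7, §2.1, §2.3.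
* [Bump1997] D. Bump, *Automorphic forms and representations*, CUP 1997, §4.4.
-/

set_option autoImplicit false
set_option linter.dupNamespace false

noncomputable section

open Function Representation
open scoped MatrixGroups
open Literature.NumberTheory.Automorphic
open Summit.HodgeConjecture.HodgeConjecture.Cruxes.H413.K2E3GL3OuterAutomorphismInduction

namespace Summit.HodgeConjecture.HodgeConjecture.Cruxes.H413.K2E3GL3StandardModuleTransport

variable {F : Type} [Field F] [ValuativeRel F] [TopologicalSpace F] [IsNonarchimedeanLocalField F]

/-! ## §1 `θ` and the two maximal parabolics in `Bool` labels -/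

/-- **`θ(P₁₂) = P₂₁`** (`Bool` labels): `θ x ∈ P_{![f,f,t]} ↔ x ∈ P_{![f,t,t]}`. [cite: Zelevinsky1980, §1.1] -/
theorem gkAutomorphism_mem_twoOne_iff (x : GL (Fin 3) F) :
    gkAutomorphism x ∈ standardParabolicGL F (![false, false, true] : Fin 3 → Bool) ↔ x ∈ standardParabolicGL F (![false, true, true] : Fin 3 → Bool) := by
  have hrel : ∀ i j : Fin 3, (![false, true, true] : Fin 3 → Bool) j < ![false, true, true] i → (![false, false, true] : Fin 3 → Bool) i.rev < ![false, false, true] j.rev := by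
    decide
  have hrel' : ∀ i j : Fin 3, (![false, false, true] : Fin 3 → Bool) j < ![false, false, true] i → (![false, true, true] : Fin 3 → Bool) i.rev < ![false, true, true] j.rev := by
    decide
  rw [← (standardParabolicGL F (![false, true, true] : Fin 3 → Bool)).inv_mem_iff (x := x), mem_standardParabolicGL_iff, mem_standardParabolicGL_iff]
  constructor
  · intro h i j hij
    have h' := h (hrel i j hij)
    rwa [coe_gkAutomorphism_apply, Fin.rev_rev, Fin.rev_rev] at h'
  · intro h i j hij
    rw [coe_gkAutomorphism_apply]
    exact h (hrel' i j hij)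

/-- **`θ(U_{P₂₁}) ⊆ U_{P₁₂}`** (`Bool` labels, in the `unipotentRadicalP` spelling). [cite: Zelevinsky1980, §1.1] -/
theorem gkAutomorphism_mem_unipotentRadicalP_oneTwo (p : ↥(standardParabolicGL F (![false, false, true] : Fin 3 → Bool)))
    (hp : p ∈ unipotentRadicalP F (![false, false, true] : Fin 3 → Bool))
    (hmem : gkAutomorphism (p : GL (Fin 3) F) ∈ standardParabolicGL F (![false, true, true] : Fin 3 → Bool)) :
    (⟨gkAutomorphism (p : GL (Fin 3) F), hmem⟩ : ↥(standardParabolicGL F (![false, true, true] : Fin 3 → Bool))) ∈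
      unipotentRadicalP F (![false, true, true] : Fin 3 → Bool) := by
  have hrel : ∀ i j : Fin 3, (![false, true, true] : Fin 3 → Bool) j < ![false, true, true] i → (![false, false, true] : Fin 3 → Bool) i.rev < ![false, false, true] j.rev := by
    decide
  have heq : ∀ i j : Fin 3, (![false, true, true] : Fin 3 → Bool) i = ![false, true, true] j → (![false, false, true] : Fin 3 → Bool) j.rev = ![false, false, true] i.rev := by
    decide
  have hx : (p : GL (Fin 3) F) ∈ unipotentRadicalGL F (![false, false, true] : Fin 3 → Bool) := (mem_unipotentRadicalP_iff F _ _).1 hp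
  have hy := (unipotentRadicalGL F (![false, false, true] : Fin 3 → Bool)).inv_mem hx
  refine (mem_unipotentRadicalP_iff F _ _).2 (mem_unipotentRadicalGL_of_apply _ (fun i j hij => ?_) (fun i j hij => ?_))
  · rw [coe_gkAutomorphism_apply]
    exact (unipotentRadicalGL_le F _ hy) (hrel i j hij)
  · rw [coe_gkAutomorphism_apply, K2E3GL3OuterAutomorphismInduction.apply_eq_of_mem_unipotentRadicalGL _ hy j.rev i.rev (heq i j hij)]
    by_cases hij' : i = j
    · subst hij'; rw [if_pos rfl, if_pos rfl]
    · rw [if_neg hij', if_neg fun h' => hij' (Fin.rev_injective h').symm]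

/-! ## §2 Block determinants of `θ(q′)` for `q′ ∈ P₁₂` -/

omit [ValuativeRel F] [TopologicalSpace F] [IsNonarchimedeanLocalField F] in
/-- `det ∘ leviProjection` multiplies to `det` on `P₁₂` (★ STD-EMB's `det_leviProjection_false_mul_true`, `![f,t,t]` version). [cite: BernsteinZelevinsky1977, §2.1] -/
theorem det_leviProjection_false_mul_true' (q : ↥(standardParabolicGL F (![false, true, true] : Fin 3 → Bool))) :
    Matrix.GeneralLinearGroup.det (leviProjection F (![false, true, true] : Fin 3 → Bool) q false) *
        Matrix.GeneralLinearGroup.det (leviProjection F (![false, true, true] : Fin 3 → Bool) q true) =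
      Matrix.GeneralLinearGroup.det (q : GL (Fin 3) F) := by
  apply Units.ext
  rw [Units.val_mul, Matrix.GeneralLinearGroup.val_det_apply, Matrix.GeneralLinearGroup.val_det_apply, Matrix.GeneralLinearGroup.val_det_apply,
    (blockTriangular_of_mem q).det_fintype, Fintype.prod_bool, K2E3GL3StandardModuleEmbedding.coe_leviProjection_eq_toSquareBlock,
    K2E3GL3StandardModuleEmbedding.coe_leviProjection_eq_toSquareBlock, mul_comm]

/-- **`det θ(g) = (det g)⁻¹`** (`θ g = w₀ ᵗ(g⁻¹) w₀`). [cite: Bump1997, §4.4] -/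
theorem det_gkAutomorphism (g : GL (Fin 3) F) : Matrix.GeneralLinearGroup.det (gkAutomorphism g) = (Matrix.GeneralLinearGroup.det g)⁻¹ := by
  rw [← map_inv]
  refine Units.ext ?_
  rw [Matrix.GeneralLinearGroup.val_det_apply, Matrix.GeneralLinearGroup.val_det_apply]
  have h : ((gkAutomorphism g : GL (Fin 3) F) : Matrix (Fin 3) (Fin 3) F) = ((((g⁻¹ : GL (Fin 3) F) : Matrix (Fin 3) (Fin 3) F)).submatrix Fin.revPerm Fin.revPerm).transpose := by
    ext i j
    rw [coe_gkAutomorphism_apply, Matrix.transpose_apply, Matrix.submatrix_apply, Fin.revPerm_apply, Fin.revPerm_apply]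
  rw [h, Matrix.det_transpose, Matrix.det_submatrix_equiv_self]

/-- The `GL₁`-block of `θ(q′)` (`q′ ∈ P₁₂`) has determinant `(q′₀₀)⁻¹` (its entry `(2,2)` is `(q′⁻¹)₀₀ = (q′₀₀)⁻¹`). [cite: Zelevinsky1980, §1.1] -/
theorem det_leviProjection_gkAutomorphism_true (q : ↥(standardParabolicGL F (![false, true, true] : Fin 3 → Bool))) :
    Matrix.GeneralLinearGroup.det (leviProjection F (![false, false, true] : Fin 3 → Bool) ⟨gkAutomorphism (q : GL (Fin 3) F), (gkAutomorphism_mem_twoOne_iff _).2 q.2⟩ true) =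
      (Matrix.GeneralLinearGroup.det (leviProjection F (![false, true, true] : Fin 3 → Bool) q false))⁻¹ := by
  rw [← map_inv, ← Pi.inv_apply, ← map_inv]
  refine Units.ext ?_
  rw [K2E3GL3InductionInStagesEmbedding.det_leviProjection_twoOne_true, K2E3GL3OneTwoLeviBookkeeping.det_leviProjection_oneTwo_false, Subgroup.coe_inv]
  change ((gkAutomorphism (q : GL (Fin 3) F) : GL (Fin 3) F) : Matrix (Fin 3) (Fin 3) F) 2 2 = _
  rw [coe_gkAutomorphism_apply]
  rfl

/-- The `GL₂`-block of `θ(q′)` (`q′ ∈ P₁₂`) has determinant `det(q′|_{\{1,2\}})⁻¹`. [cite: Zelevinsky1980, §1.1] -/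
theorem det_leviProjection_gkAutomorphism_false (q : ↥(standardParabolicGL F (![false, true, true] : Fin 3 → Bool))) :
    Matrix.GeneralLinearGroup.det (leviProjection F (![false, false, true] : Fin 3 → Bool) ⟨gkAutomorphism (q : GL (Fin 3) F), (gkAutomorphism_mem_twoOne_iff _).2 q.2⟩ false) =
      (Matrix.GeneralLinearGroup.det (leviProjection F (![false, true, true] : Fin 3 → Bool) q true))⁻¹ := by
  have h1 : Matrix.GeneralLinearGroup.det (leviProjection F (![false, false, true] : Fin 3 → Bool) ⟨gkAutomorphism (q : GL (Fin 3) F), (gkAutomorphism_mem_twoOne_iff _).2 q.2⟩ false) *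
      Matrix.GeneralLinearGroup.det (leviProjection F (![false, false, true] : Fin 3 → Bool) ⟨gkAutomorphism (q : GL (Fin 3) F), (gkAutomorphism_mem_twoOne_iff _).2 q.2⟩ true) =
      Matrix.GeneralLinearGroup.det (gkAutomorphism (q : GL (Fin 3) F)) :=
    K2E3GL3StandardModuleEmbedding.det_leviProjection_false_mul_true
      (⟨gkAutomorphism (q : GL (Fin 3) F), (gkAutomorphism_mem_twoOne_iff _).2 q.2⟩ : ↥(standardParabolicGL F (![false, false, true] : Fin 3 → Bool)))
  rw [det_leviProjection_gkAutomorphism_true, det_gkAutomorphism, ← det_leviProjection_false_mul_true' q, mul_inv, mul_comm (Matrix.GeneralLinearGroup.det _)⁻¹] at h1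
  exact mul_right_cancel h1

/-! ## §3 The transport equivalence `Φ : D′(x,y) ≃ D(y⁻¹,x⁻¹)` -/

/-- **`σ′_{Q′}(x,y)(q′) = σ′_Q(y⁻¹,x⁻¹)(θ q′)`** for `q′ ∈ P₁₂`: the inducing data correspond under `θ` (`δ_{Q′} = δ_Q ∘ θ` ★ `rootDeltaChar_transport`, and §2).
[cite: BernsteinZelevinsky1977, 1.7, §2.3] [cite: Zelevinsky1980, §1.1] -/
theorem inducingChar_oneTwo_eq_twoOne_gkAutomorphism (x y : Fˣ →* ℂˣ) (q : ↥(standardParabolicGL F (![false, true, true] : Fin 3 → Bool))) :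
    (Representation.twist (((Representation.trivial ℂ (Π a : Bool, GL {i : Fin 3 // (![false, true, true] : Fin 3 → Bool) i = a} F) ℂ).twist
        ((x.comp (Matrix.GeneralLinearGroup.det.comp (Pi.evalMonoidHom (fun a : Bool => GL {i : Fin 3 // (![false, true, true] : Fin 3 → Bool) i = a} F) false))) *
          (y.comp (Matrix.GeneralLinearGroup.det.comp (Pi.evalMonoidHom (fun a : Bool => GL {i : Fin 3 // (![false, true, true] : Fin 3 → Bool) i = a} F) true))))).comp
        (leviProjection F (![false, true, true] : Fin 3 → Bool))) (rootDeltaChar (standardParabolicGL F (![false, true, true] : Fin 3 → Bool)))) q =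
      (Representation.twist (((Representation.trivial ℂ (Π a : Bool, GL {i : Fin 3 // (![false, false, true] : Fin 3 → Bool) i = a} F) ℂ).twist
        ((y⁻¹.comp (Matrix.GeneralLinearGroup.det.comp (Pi.evalMonoidHom (fun a : Bool => GL {i : Fin 3 // (![false, false, true] : Fin 3 → Bool) i = a} F) false))) *
          (x⁻¹.comp (Matrix.GeneralLinearGroup.det.comp (Pi.evalMonoidHom (fun a : Bool => GL {i : Fin 3 // (![false, false, true] : Fin 3 → Bool) i = a} F) true))))).comp
        (leviProjection F (![false, false, true] : Fin 3 → Bool))) (rootDeltaChar (standardParabolicGL F (![false, false, true] : Fin 3 → Bool))))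
        ⟨gkAutomorphism (q : GL (Fin 3) F), (gkAutomorphism_mem_twoOne_iff _).2 q.2⟩ := by
  haveI : IsTopologicalRing F := inferInstance
  have hδ := rootDeltaChar_transport (gkAutomorphism : GL (Fin 3) F ≃ₜ* GL (Fin 3) F).toMulEquiv (gkAutomorphism : GL (Fin 3) F ≃ₜ* GL (Fin 3) F).continuous
    (gkAutomorphism : GL (Fin 3) F ≃ₜ* GL (Fin 3) F).symm.continuous (H := standardParabolicGL F (![false, false, true] : Fin 3 → Bool))
    (H' := standardParabolicGL F (![false, true, true] : Fin 3 → Bool)) (fun z => gkAutomorphism_mem_twoOne_iff z) q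
  refine LinearMap.ext fun z => ?_
  simp only [Representation.twist_apply, MonoidHom.coe_comp, Function.comp_apply, Representation.trivial_apply, MonoidHom.mul_apply, MonoidHom.inv_apply,
    Pi.evalMonoidHom_apply, det_leviProjection_gkAutomorphism_true, det_leviProjection_gkAutomorphism_false, map_inv, inv_inv, Units.val_mul, smul_smul]
  rw [hδ, mul_comm ((x _ : ℂˣ) : ℂ)]
  rfl

/-- **THE TRANSPORT EQUIVALENCE `Φ : D′(x,y) ≃ D(y⁻¹,x⁻¹)`**: a linear isomorphism from the `P₁₂`-standard module `D′(x,y) = parabolicIndGL F ![f,t,t] (𝟙.twist ψ_{Q′}(x,y))`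
onto the `P₂₁`-standard module `D(y⁻¹,x⁻¹) = parabolicIndGL F ![f,f,t] (𝟙.twist ψ_Q(y⁻¹,x⁻¹))` (★ STD-EMB currency) with `Φ (D′(g) v) = D(θ g) (Φ v)` for `θ = gkAutomorphism`
(★ `SmoothInd.transportEquiv` on §3's correspondence of inducing data). [cite: Zelevinsky1980, §1.1, Ex. 3.2] [cite: BernsteinZelevinsky1977, §2.3] -/
theorem exists_transportEquiv_D' (x y : Fˣ →* ℂˣ) :
    ∃ Φ : SmoothInd (standardParabolicGL F (![false, true, true] : Fin 3 → Bool))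
        (Representation.twist (((Representation.trivial ℂ (Π a : Bool, GL {i : Fin 3 // (![false, true, true] : Fin 3 → Bool) i = a} F) ℂ).twist
          ((x.comp (Matrix.GeneralLinearGroup.det.comp (Pi.evalMonoidHom (fun a : Bool => GL {i : Fin 3 // (![false, true, true] : Fin 3 → Bool) i = a} F) false))) *
            (y.comp (Matrix.GeneralLinearGroup.det.comp (Pi.evalMonoidHom (fun a : Bool => GL {i : Fin 3 // (![false, true, true] : Fin 3 → Bool) i = a} F) true))))).comp
          (leviProjection F (![false, true, true] : Fin 3 → Bool))) (rootDeltaChar (standardParabolicGL F (![false, true, true] : Fin 3 → Bool)))) ≃ₗ[ℂ]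
      SmoothInd (standardParabolicGL F (![false, false, true] : Fin 3 → Bool))
        (Representation.twist (((Representation.trivial ℂ (Π a : Bool, GL {i : Fin 3 // (![false, false, true] : Fin 3 → Bool) i = a} F) ℂ).twist
          ((y⁻¹.comp (Matrix.GeneralLinearGroup.det.comp (Pi.evalMonoidHom (fun a : Bool => GL {i : Fin 3 // (![false, false, true] : Fin 3 → Bool) i = a} F) false))) *
            (x⁻¹.comp (Matrix.GeneralLinearGroup.det.comp (Pi.evalMonoidHom (fun a : Bool => GL {i : Fin 3 // (![false, false, true] : Fin 3 → Bool) i = a} F) true))))).comp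
          (leviProjection F (![false, false, true] : Fin 3 → Bool))) (rootDeltaChar (standardParabolicGL F (![false, false, true] : Fin 3 → Bool)))),
      ∀ (g : GL (Fin 3) F) v, Φ (Representation.parabolicIndGL F (![false, true, true] : Fin 3 → Bool)
          ((Representation.trivial ℂ (Π a : Bool, GL {i : Fin 3 // (![false, true, true] : Fin 3 → Bool) i = a} F) ℂ).twist
            ((x.comp (Matrix.GeneralLinearGroup.det.comp (Pi.evalMonoidHom (fun a : Bool => GL {i : Fin 3 // (![false, true, true] : Fin 3 → Bool) i = a} F) false))) *
              (y.comp (Matrix.GeneralLinearGroup.det.comp (Pi.evalMonoidHom (fun a : Bool => GL {i : Fin 3 // (![false, true, true] : Fin 3 → Bool) i = a} F) true))))) g v) =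
        Representation.parabolicIndGL F (![false, false, true] : Fin 3 → Bool)
          ((Representation.trivial ℂ (Π a : Bool, GL {i : Fin 3 // (![false, false, true] : Fin 3 → Bool) i = a} F) ℂ).twist
            ((y⁻¹.comp (Matrix.GeneralLinearGroup.det.comp (Pi.evalMonoidHom (fun a : Bool => GL {i : Fin 3 // (![false, false, true] : Fin 3 → Bool) i = a} F) false))) *
              (x⁻¹.comp (Matrix.GeneralLinearGroup.det.comp (Pi.evalMonoidHom (fun a : Bool => GL {i : Fin 3 // (![false, false, true] : Fin 3 → Bool) i = a} F) true)))))
          (gkAutomorphism g) (Φ v) := by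
  haveI : IsTopologicalRing F := inferInstance
  refine ⟨SmoothInd.transportEquiv (gkAutomorphism : GL (Fin 3) F ≃ₜ* GL (Fin 3) F).toMulEquiv (gkAutomorphism : GL (Fin 3) F ≃ₜ* GL (Fin 3) F).continuous
    (gkAutomorphism : GL (Fin 3) F ≃ₜ* GL (Fin 3) F).symm.continuous (H := standardParabolicGL F (![false, false, true] : Fin 3 → Bool))
    (H' := standardParabolicGL F (![false, true, true] : Fin 3 → Bool)) (fun z => gkAutomorphism_mem_twoOne_iff z)
    (fun q => inducingChar_oneTwo_eq_twoOne_gkAutomorphism x y q), fun g v => ?_⟩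
  exact SmoothInd.transportEquiv_smoothIndRep _ _ _ _ _ g v

end Summit.HodgeConjecture.HodgeConjecture.Cruxes.H413.K2E3GL3StandardModuleTransport

end
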